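import Summits.KontsevichZagierPeriods.KontsevichZagierPeriods.Theorems.RootDecompRelativeModAbsoluteCircleLogP4

/-! # `RootDecompRelativeModAbsoluteCircleLogP5` — part 5/11 of the mechanical ≤400-line split of `CircleLogTranscendence_landing.lean` (sha256 022159109aaffa3a…)
Source: decomp-kz lens-3 g13 `CircleLogTranscendence_v9.lean` (HOME/decomp-kz-lens-3/g13/, sha256 afb45a43…; critic g5-45/60/65/68/69 CLEARED FOR LANDING --supports 30572 (§4 defs, §8–§10 CircleLogStructureAt 0 from the tree's baker_decomposition_complex, constant-data cells every n, §16–§23 descent ingredients); landed by census-1 g9 over the landed CylLogSplitP52 (BLOCK G13): the duplicate def CircleLogStructure is dropped in favour of the landed one).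
Split by census-1 g9 `gen/splitlean.py`: scopes re-opened with their `open`/`variable`/`set_option` context; mathematics and declaration order unchanged. -/

noncomputable section
open Set MeasureTheory Filter Topology
open scoped BigOperators
open Literature.NumberTheory.Transcendental Literature.ModelTheory.ExponentialFields
namespace Summit.KontsevichZagierPeriods.RootDecompRelativeModAbsolute.Rung30571.RegularisedLogLayer.CylLog.Leaf
namespace G13

/-- **Interval cells.** An open `ℚ`-sa `G ⊆ ℝ¹` is, up to a null set, a finite disjoint union of open CONVEX `ℚ`-sa cells
(open intervals), each either inside or disjoint from each of finitely many given `ℚ`-sa sets `Zᵢ` — the bands of a cylindrical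
decomposition of `ℝ¹` adapted to `G, Z₁, …, Z_m` (tree CAD over the coefficient field `ℚ`). -/
theorem exists_interval_cells {m : ℕ} {G : Set (Fin 1 → ℝ)} (hG : IsSemialgebraic ℚ G)
    (Z : Fin m → Set (Fin 1 → ℝ)) (hZ : ∀ i, IsSemialgebraic ℚ (Z i)) :
    ∃ (B : ℕ) (T : Fin B → Set (Fin 1 → ℝ)),
      (∀ b, IsSemialgebraic ℚ (T b) ∧ IsOpen (T b) ∧ Convex ℝ (T b) ∧ T b ⊆ G) ∧
      Pairwise (Function.onFun Disjoint T) ∧ volume (G \ ⋃ b, T b) = 0 ∧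
      ∀ b i, T b ⊆ Z i ∨ Disjoint (T b) (Z i) := by
  classical
  set F : Finset (Set (Fin 1 → ℝ)) := insert G (Finset.univ.image Z) with hF
  have hFsa : ∀ s ∈ F, IsSemialgebraic ℚ s := by
    intro s hs
    rcases Finset.mem_insert.mp hs with rfl | hs
    · exact hG
    · obtain ⟨i, -, rfl⟩ := Finset.mem_image.mp hs
      exact hZ i
  obtain ⟨𝒮, h𝒮, hadapt⟩ := IsSemialgebraic.exists_cylindricalDecomposition_holds (k := ℚ) F hFsa
  have hpart := h𝒮.isPartition
  have hsa𝒮 := h𝒮.isSemialgebraic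
  obtain ⟨𝒮₀, h𝒮₀, l, ξ, -, -, -, hcells⟩ := h𝒮.exists_isCylinderStack
  have h𝒮₀' : 𝒮₀ = {univ} := (isCylindricalDecomposition_zero (k := ℚ)).mp h𝒮₀
  set x₀ : Fin 0 → ℝ := finZeroElim with hx₀
  -- every cell is a point `{z | z 0 = ξⱼ}` or an open interval
  have hcell : ∀ T ∈ 𝒮, (∃ j, T ⊆ {z : Fin 1 → ℝ | z (Fin.last 0) = ξ univ j x₀}) ∨
      (IsOpen T ∧ Convex ℝ T) := by
    intro T hT
    obtain ⟨S, hS, hT'⟩ := (hcells T).mp hT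
    rw [h𝒮₀', Finset.mem_singleton] at hS
    subst hS
    rcases hT' with ⟨j, rfl⟩ | ⟨j, rfl⟩
    · left
      refine ⟨j, fun z hz => ?_⟩
      have h2 := (mem_graphOver_iff.mp hz).2
      rw [Subsingleton.elim (Fin.init z) x₀] at h2
      exact h2
    · right
      set I : Set ℝ := {t : ℝ | bandLower (ξ univ) j x₀ < (t : EReal) ∧ (t : EReal) < bandUpper (ξ univ) j x₀}
        with hI
      have hTeq : bandOver univ (ξ univ) j = (fun z : Fin (0 + 1) → ℝ => z (Fin.last 0)) ⁻¹' I := by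
        ext z
        rw [mem_bandOver_iff, Subsingleton.elim (Fin.init z) x₀]
        simp [hI]
      have hIo : IsOpen I := by
        have : I = (fun t : ℝ => (t : EReal)) ⁻¹' Set.Ioo (bandLower (ξ univ) j x₀) (bandUpper (ξ univ) j x₀) := rfl
        rw [this]
        exact isOpen_Ioo.preimage continuous_coe_real_ereal
      have hIc : Convex ℝ I := by
        refine Set.OrdConnected.convex ⟨fun a ha b hb t ht => ⟨?_, ?_⟩⟩
        · exact lt_of_lt_of_le ha.1 (EReal.coe_le_coe_iff.mpr ht.1)
        · exact lt_of_le_of_lt (EReal.coe_le_coe_iff.mpr ht.2) hb.2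
      rw [hTeq]
      refine ⟨hIo.preimage (continuous_apply _), ?_⟩
      intro z hz w hw a b ha hb hab
      have h1 := hIc hz hw ha hb hab
      simpa [Pi.add_apply, Pi.smul_apply, smul_eq_mul] using h1
  -- the kept cells: open intervals inside `G`
  set 𝒯 := 𝒮.filter (fun T => T ⊆ G ∧ IsOpen T ∧ Convex ℝ T) with h𝒯
  have hmem : ∀ b : Fin 𝒯.card, ((𝒯.equivFin.symm b : 𝒯) : Set (Fin 1 → ℝ)) ∈ 𝒮 ∧
      ((𝒯.equivFin.symm b : 𝒯) : Set (Fin 1 → ℝ)) ⊆ G ∧ IsOpen ((𝒯.equivFin.symm b : 𝒯) : Set (Fin 1 → ℝ)) ∧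
      Convex ℝ ((𝒯.equivFin.symm b : 𝒯) : Set (Fin 1 → ℝ)) := fun b =>
    Finset.mem_filter.mp (𝒯.equivFin.symm b).2
  refine ⟨𝒯.card, fun b => ((𝒯.equivFin.symm b : 𝒯) : Set (Fin 1 → ℝ)),
    fun b => ⟨hsa𝒮 _ (hmem b).1, (hmem b).2.2.1, (hmem b).2.2.2, (hmem b).2.1⟩, ?_, ?_, fun b i => ?_⟩
  · intro b b' hbb'
    have hne : ((𝒯.equivFin.symm b : 𝒯) : Set (Fin 1 → ℝ)) ≠ (𝒯.equivFin.symm b' : 𝒯) := fun h =>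
      hbb' (𝒯.equivFin.symm.injective (Subtype.ext h))
    exact hpart.pairwiseDisjoint (Finset.mem_coe.mpr (hmem b).1) (Finset.mem_coe.mpr (hmem b').1) hne
  · -- null complement: the uncovered part of `G` lies on the finitely many points
    have hN : volume (⋃ j : Fin (l univ), {z : Fin 1 → ℝ | z (Fin.last 0) = ξ univ j x₀}) = 0 :=
      measure_iUnion_null fun j => volume_setOf_apply_last_eq _
    refine measure_mono_null (fun x hx => ?_) hN
    obtain ⟨hxG, hxT⟩ := hx
    obtain ⟨𝒞, h𝒞𝒮, hG𝒞⟩ := hadapt G (Finset.mem_insert_self _ _)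
    have hx' : x ∈ ⋃₀ (𝒞 : Set (Set (Fin 1 → ℝ))) := by rw [hG𝒞]; exact hxG
    obtain ⟨T', hT'𝒞, hxT'⟩ := Set.mem_sUnion.mp hx'
    have hT'𝒞' : T' ∈ 𝒞 := Finset.mem_coe.mp hT'𝒞
    have hT'𝒮 : T' ∈ 𝒮 := h𝒞𝒮 hT'𝒞'
    have hT'G : T' ⊆ G := by
      rw [← hG𝒞]
      exact Set.subset_sUnion_of_mem hT'𝒞
    rcases hcell T' hT'𝒮 with ⟨j, hj⟩ | ⟨ho, hconv⟩
    · exact Set.mem_iUnion.mpr ⟨j, hj hxT'⟩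
    · exfalso
      apply hxT
      have hT'𝒯 : T' ∈ 𝒯 := Finset.mem_filter.mpr ⟨hT'𝒮, hT'G, ho, hconv⟩
      refine Set.mem_iUnion.mpr ⟨𝒯.equivFin ⟨T', hT'𝒯⟩, ?_⟩
      simp only [Equiv.symm_apply_apply]
      exact hxT'
  · -- inside or disjoint from `Z i`
    obtain ⟨𝒞, h𝒞𝒮, hZ𝒞⟩ :=
      hadapt (Z i) (Finset.mem_insert_of_mem (Finset.mem_image_of_mem Z (Finset.mem_univ i)))
    by_cases hT𝒞 : ((𝒯.equivFin.symm b : 𝒯) : Set (Fin 1 → ℝ)) ∈ 𝒞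
    · left
      rw [← hZ𝒞]
      exact Set.subset_sUnion_of_mem (Finset.mem_coe.mpr hT𝒞)
    · right
      rw [← hZ𝒞, Set.disjoint_sUnion_right]
      intro T'' hT''
      have hT''𝒞 : T'' ∈ 𝒞 := Finset.mem_coe.mp hT''
      exact hpart.pairwiseDisjoint (Finset.mem_coe.mpr (hmem b).1) (Finset.mem_coe.mpr (h𝒞𝒮 hT''𝒞))
        (fun h => hT𝒞 (h ▸ hT''𝒞))

/-! #### §10b Flattening a two-level a.e. partition. -/

/-- Auxiliary step `exists_flatten_partition` (§10b): exists flatten partition. [bookkeeping] -/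
theorem exists_flatten_partition {n B : ℕ} {G : Set (Fin n → ℝ)} (T : Fin B → Set (Fin n → ℝ))
    (hTG : ∀ b, T b ⊆ G) (hTd : Pairwise (Function.onFun Disjoint T)) (hTn : volume (G \ ⋃ b, T b) = 0)
    (N : Fin B → ℕ) (C : (b : Fin B) → Fin (N b) → Set (Fin n → ℝ))
    (hCT : ∀ b c, C b c ⊆ T b) (hCd : ∀ b, Pairwise (Function.onFun Disjoint (C b)))
    (hCn : ∀ b, volume (T b \ ⋃ c, C b c) = 0) {P : Set (Fin n → ℝ) → Prop} (hP : ∀ b c, P (C b c)) :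
    ∃ (M : ℕ) (E : Fin M → Set (Fin n → ℝ)), (∀ j, E j ⊆ G ∧ P (E j)) ∧
      Pairwise (Function.onFun Disjoint E) ∧ volume (G \ ⋃ j, E j) = 0 := by
  classical
  set e : (Σ b : Fin B, Fin (N b)) ≃ Fin (∑ b, N b) := finSigmaFinEquiv with he
  refine ⟨∑ b, N b, fun j => C (e.symm j).1 (e.symm j).2,
    fun j => ⟨(hCT _ _).trans (hTG _), hP _ _⟩, ?_, ?_⟩
  · intro j j' hjj'
    show Disjoint (C (e.symm j).1 (e.symm j).2) (C (e.symm j').1 (e.symm j').2)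
    have hne : e.symm j ≠ e.symm j' := fun h => hjj' (e.symm.injective h)
    generalize e.symm j = σ at hne ⊢
    generalize e.symm j' = σ' at hne ⊢
    obtain ⟨b, c⟩ := σ
    obtain ⟨b', c'⟩ := σ'
    by_cases hb : b = b'
    · subst hb
      have hc : c ≠ c' := fun h => hne (by subst h; rfl)
      exact hCd b hc
    · exact Disjoint.mono (hCT b c) (hCT b' c') (hTd hb)
  · have hsub : G \ ⋃ j, C (e.symm j).1 (e.symm j).2 ⊆
        (G \ ⋃ b, T b) ∪ ⋃ b, (T b \ ⋃ c, C b c) := by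
      rintro x ⟨hxG, hxE⟩
      by_cases hxT : x ∈ ⋃ b, T b
      · right
        obtain ⟨b, hb⟩ := Set.mem_iUnion.mp hxT
        refine Set.mem_iUnion.mpr ⟨b, hb, fun hxC => hxE ?_⟩
        obtain ⟨c, hc⟩ := Set.mem_iUnion.mp hxC
        refine Set.mem_iUnion.mpr ⟨e ⟨b, c⟩, ?_⟩
        rw [Equiv.symm_apply_apply]
        exact hc
      · exact Or.inl ⟨hxG, hxT⟩
    exact measure_mono_null hsub (measure_union_null hTn (measure_iUnion_null fun b => hCn b))

/-! #### §10c Constancy on an interval cell from a vanishing derivative. -/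

/-- Auxiliary step `eq_of_fderiv_single_eq_zero` (§10c): eq of fderiv single eq zero. [bookkeeping] -/
theorem eq_of_fderiv_single_eq_zero {T : Set (Fin 1 → ℝ)} (hTo : IsOpen T) (hTc : Convex ℝ T)
    {f : (Fin 1 → ℝ) → ℝ} (hf : DifferentiableOn ℝ f T)
    (h0 : ∀ x ∈ T, fderiv ℝ f x (Pi.single 0 1) = 0) : ∀ x ∈ T, ∀ y ∈ T, f x = f y := by
  intro x hx y hy
  refine hTc.is_const_of_fderivWithin_eq_zero hf (fun z hz => ?_) hx hy
  rw [fderivWithin_of_isOpen hTo hz]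
  refine ContinuousLinearMap.ext fun w => ?_
  have hw : w = w 0 • (Pi.single 0 1 : Fin 1 → ℝ) := by
    funext j
    rw [Subsingleton.elim j 0]
    simp
  rw [hw, map_smul, h0 z hz, smul_zero]; rfl

/-! #### §10d The MOVING-DATA residual and the reduction `CircleLogStructureAt 1 ⟸ (constant cells: §9) + moving cells`. -/

open scoped ContDiff in
/-- **The MOVING-DATA residual of `CircleLogStructureAt 1`** (the one remaining transcendence input — functional, Ax–Schanuel
type — of the circle/log structure theorem in base dimension one): `CircleLogStructure`'s conclusion for an open INTERVAL cell
`U ⊆ ℝ¹` (`ℚ`-sa, open, convex) on which all `Wᵢ`, `uⱼ` are `C^∞`, EACH `Wᵢ`, `uⱼ` is either constant (`∂Wᵢ ≡ 0`) or strictly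
moving (`∂Wᵢ` vanishes nowhere), and AT LEAST ONE of them moves. -/
def CircleLogStructureMoving : Prop :=
  ∀ (k l : ℕ) (U : Set (Fin 1 → ℝ)) (h W : Fin k → (Fin 1 → ℝ) → ℝ) (p u : Fin l → (Fin 1 → ℝ) → ℝ)
    (g : (Fin 1 → ℝ) → ℝ),
    IsSemialgebraic ℚ U → IsOpen U → Convex ℝ U → (∀ i, IsSemialgebraicFunOn ℚ U (h i)) →
    (∀ i, IsSemialgebraicFunOn ℚ U (W i)) → (∀ i, ∀ x ∈ U, 0 < W i x) →
    (∀ j, IsSemialgebraicFunOn ℚ U (p j)) → (∀ j, IsSemialgebraicFunOn ℚ U (u j)) →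
    IsSemialgebraicFunOn ℚ U g →
    (∀ i, ContDiffOn ℝ ∞ (W i) U) → (∀ j, ContDiffOn ℝ ∞ (u j) U) →
    (∀ i, (∀ x ∈ U, fderiv ℝ (W i) x (Pi.single 0 1) = 0) ∨ (∀ x ∈ U, fderiv ℝ (W i) x (Pi.single 0 1) ≠ 0)) →
    (∀ j, (∀ x ∈ U, fderiv ℝ (u j) x (Pi.single 0 1) = 0) ∨ (∀ x ∈ U, fderiv ℝ (u j) x (Pi.single 0 1) ≠ 0)) →
    ((∃ i, ∀ x ∈ U, fderiv ℝ (W i) x (Pi.single 0 1) ≠ 0) ∨ (∃ j, ∀ x ∈ U, fderiv ℝ (u j) x (Pi.single 0 1) ≠ 0)) →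
    (∀ x ∈ U, ∑ i, h i x * Real.log (W i x) + ∑ j, p j x * Real.arctan (u j x) = g x) →
    ∃ (N : ℕ) (C : Fin N → Set (Fin 1 → ℝ)),
      (∀ c, IsSemialgebraic ℚ (C c) ∧ IsOpen (C c) ∧ C c ⊆ U) ∧
      Pairwise (Function.onFun Disjoint C) ∧ volume (U \ ⋃ c, C c) = 0 ∧
      ∀ c, (∀ x ∈ C c, g x = 0) ∧
        ∃ (R : ℕ) (f : Fin R → Fin k → ℤ) (q : Fin R → (Fin 1 → ℝ) → ℝ)
          (S : ℕ) (f' : Fin S → Fin l → ℤ) (m : Fin S → ℚ) (q' : Fin S → (Fin 1 → ℝ) → ℝ),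
          (∀ r, IsSemialgebraicFunOn ℚ (C c) (q r)) ∧ (∀ r, ∀ x ∈ C c, ∏ i, W i x ^ (f r i) = 1) ∧
          (∀ i, ∀ x ∈ C c, h i x = ∑ r, q r x * (f r i : ℝ)) ∧
          (∀ s, IsSemialgebraicFunOn ℚ (C c) (q' s)) ∧
          (∀ s, ∀ x ∈ C c, ∑ j, (f' s j : ℝ) * Real.arctan (u j x) = (m s : ℝ) * Real.pi) ∧
          (∀ x ∈ C c, ∑ s, q' s x * (m s : ℝ) = 0) ∧
          (∀ j, ∀ x ∈ C c, p j x = ∑ s, q' s x * (f' s j : ℝ))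

end G13
end Summit.KontsevichZagierPeriods.RootDecompRelativeModAbsolute.Rung30571.RegularisedLogLayer.CylLog.Leaf
end
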